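import Mathlib
import HarnessLib
import Literature.Analysis.FluidPDE.VectorCalculus
import Literature.Analysis.FluidPDE.DecayingSelfSimilarEulerProfile
import Summits.NavierStokesRegularity.NavierStokesRegularity.Theorems.ImplosionDoorTangentialCurlFreeTrivialityBochner
import Summits.NavierStokesRegularity.NavierStokesRegularity.Theorems.EulerZoomLiouvillePowerGaugeEulerLiouvilleProfileEnergyTools

/-!
# `ImplosionDoor.TangentialCurlFreeTriviality` (stmt-NavierStokesRegularity-25306) — KINEMATIC RIGIDITY, part 2/2:
# a `C²` sphere-tangential, divergence-free vector field on `ℝ³` with zero radial vorticity moment vanishes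

**Theorem (`eq_zero_of_tangential_divFree_radialCurlFree`).**  Let `w : ℝ³ → ℝ³` be `C²` with
`⟪w(y), y⟫ = 0` (sphere-tangential), `div w = 0` and `⟪curl w(y), y⟫ = 0` for every `y`.  Then `w ≡ 0`.
Classically: on each sphere `S_r` the restriction of `w` is a tangent field with vanishing surface divergence
(`= div w`, by tangency) and surface curl (`= ⟪curl w, ŷ⟫`), i.e. a harmonic 1-form on `S²`, hence zero
(`H¹(S²) = 0`) [Davidson 2001, App.; Majda–Bertozzi 2002, §1].  Proof here = Bochner's argument in ambient
coordinates: part 1/2 (`…TangentialCurlFreeTrivialityBochner`) gives the tangential field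
`U = |y|² (w·∇)w + |w|² y` with `div U = |y|² tr((Dw)²) + 2⟪w, Dw y⟫ + |w|² ≥ |w|²` (`key_ineq`), and
`div(k(|y|²) U) = k(|y|²) div U`.  This file adds
* INTEGRATION (`integral_divergence_eq_zero`): `∫ div V = 0` for `C¹` compactly supported `V` (Mathlib's
  integration by parts `integral_smul_fderiv_eq_neg_fderiv_smul_of_integrable` against the constant `1`);
* the CONCLUSION: with `k ≥ 0` a smooth bump around `|y₀|²` supported in `(0, ∞)`, `div (k(|y|²) U) ≥ k |w|² ≥ 0`
  is continuous, compactly supported, with zero integral, hence zero; at `y₀` this gives `w(y₀) = 0`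
  (`y₀ ≠ 0`), and `w(0) = 0` by continuity.

USE.  The class of the door routes (Type-I ancient Oseen-mild) has real-analytic slices, so the research stub
`stub_sliceZero` of crux `TangentialCurlFreeTriviality` is this theorem applied slice by slice
(file `…TangentialCurlFreeTrivialityStubSliceZero`).

HONEST FRAMING: pure vector calculus on `ℝ³` (kinematics of a HYPOTHETICAL blow-up profile's slice); nothing
here bears on Navier–Stokes regularity; no summit statement is proved.
-/

noncomputable section

-- the summit and its single sub-problem share the name (CONVENTIONS §1), as in every Theorems file
set_option linter.dupNamespace false

namespace Summit.NavierStokesRegularity.NavierStokesRegularity.Theorems.ImplosionDoorTangentialCurlFreeTrivialityKinematics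

open Set Function MeasureTheory Metric
open scoped RealInnerProductSpace InnerProductSpace Topology
open Literature.Analysis Literature.Analysis.FluidPDE
open Summit.NavierStokesRegularity.NavierStokesRegularity.Theorems.ImplosionDoorTangentialCurlFreeTrivialityBochner
open Summit.NavierStokesRegularity.NavierStokesRegularity.Theorems.PowerGaugeEulerLiouville.ProfileEnergy
  (continuous_divergence_of_contDiff_one)

variable {w : EuclideanSpace ℝ (Fin 3) → EuclideanSpace ℝ (Fin 3)}

/-! ### Integration: `∫ div V = 0` for compactly supported `C¹` fields -/

/-- `∫ DV(x) v dx = 0` for a `C¹` compactly supported field (integration by parts against `1`). [folklore] -/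
theorem integral_fderiv_apply_eq_zero {V : EuclideanSpace ℝ (Fin 3) → EuclideanSpace ℝ (Fin 3)}
    (hV : ContDiff ℝ 1 V) (hVc : HasCompactSupport V) (v : EuclideanSpace ℝ (Fin 3)) :
    ∫ x, fderiv ℝ V x v = 0 := by
  have hDc : Continuous fun x => fderiv ℝ V x v := (hV.continuous_fderiv one_ne_zero).clm_apply continuous_const
  have hI : Integrable (fun x => fderiv ℝ V x v) := hDc.integrable_of_hasCompactSupport (hVc.fderiv_apply (𝕜 := ℝ) v)
  have h := integral_smul_fderiv_eq_neg_fderiv_smul_of_integrable (μ := (volume : Measure (EuclideanSpace ℝ (Fin 3))))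
    (f := fun _ : EuclideanSpace ℝ (Fin 3) => (1 : ℝ)) (g := V) (v := v)
    (by simp) (by simpa using hI) (by simpa using hV.continuous.integrable_of_hasCompactSupport hVc)
    (fun x _ => differentiableAt_const _) (fun x _ => hV.differentiable one_ne_zero x)
  simpa using h

/-- **`∫ div V = 0`** for a `C¹` compactly supported vector field on `ℝ³`. [folklore] -/
theorem integral_divergence_eq_zero {V : EuclideanSpace ℝ (Fin 3) → EuclideanSpace ℝ (Fin 3)}
    (hV : ContDiff ℝ 1 V) (hVc : HasCompactSupport V) : ∫ x, VectorCalculus.divergence V x = 0 := by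
  set b := EuclideanSpace.basisFun (Fin 3) ℝ
  have hDc : ∀ i, Continuous fun x => fderiv ℝ V x (b i) := fun i =>
    (hV.continuous_fderiv one_ne_zero).clm_apply continuous_const
  have hI : ∀ i, Integrable (fun x => ⟪b i, fderiv ℝ V x (b i)⟫) := fun i =>
    (continuous_const.inner (hDc i)).integrable_of_hasCompactSupport
      ((hVc.fderiv_apply (𝕜 := ℝ) (b i)).mono fun x hx => by
        rw [Function.mem_support] at hx ⊢
        intro h0
        exact hx (by rw [h0, inner_zero_right]))
  simp_rw [divergence_eq_sum_inner_fderiv b]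
  rw [integral_finsetSum _ fun i _ => hI i]
  refine Finset.sum_eq_zero fun i _ => ?_
  rw [integral_inner ((hDc i).integrable_of_hasCompactSupport (hVc.fderiv_apply (𝕜 := ℝ) (b i))),
    integral_fderiv_apply_eq_zero hV hVc, inner_zero_right]

/-- The divergence of a compactly supported field is compactly supported. [folklore] -/
theorem hasCompactSupport_divergence {V : EuclideanSpace ℝ (Fin 3) → EuclideanSpace ℝ (Fin 3)}
    (hVc : HasCompactSupport V) : HasCompactSupport (VectorCalculus.divergence V) := by
  refine (hVc.fderiv (𝕜 := ℝ)).mono fun x hx => ?_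
  rw [Function.mem_support] at hx ⊢
  intro h0
  apply hx
  unfold VectorCalculus.divergence
  rw [h0]
  simp

/-! ### The kinematic rigidity theorem -/

/-- **KINEMATIC RIGIDITY.**  A `C²` vector field on `ℝ³` which is sphere-tangential (`⟪w(y), y⟫ = 0`),
divergence free, and has zero radial vorticity moment (`⟪curl w(y), y⟫ = 0`) vanishes identically
(harmonic 1-forms on `S²` are zero — here via the Bochner identity in ambient coordinates, see the module
docstring). [cite: Davidson2001, App. (poloidal–toroidal kinematics); folklore] -/
theorem eq_zero_of_tangential_divFree_radialCurlFree (hw : ContDiff ℝ 2 w) (htan : ∀ y, ⟪w y, y⟫ = 0)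
    (hdiv : ∀ y, VectorCalculus.divergence w y = 0) (hcurl : ∀ y, ⟪curl w y, y⟫ = 0) : w = 0 := by
  have hwd : Differentiable ℝ w := hw.differentiable two_ne_zero
  -- ### off the origin
  have hoff : ∀ y₀ : EuclideanSpace ℝ (Fin 3), y₀ ≠ 0 → w y₀ = 0 := by
    intro y₀ hy₀
    set ρ : ℝ := ‖y₀‖ ^ 2 with hρ
    have hρ0 : 0 < ρ := by positivity
    -- a smooth bump `k ≥ 0` around `ρ = |y₀|²`, supported in `(ρ/2, 3ρ/2) ⊂ (0, ∞)`
    let k : ContDiffBump (ρ : ℝ) := ⟨ρ / 4, ρ / 2, by positivity, by linarith⟩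
    set U : EuclideanSpace ℝ (Fin 3) → EuclideanSpace ℝ (Fin 3) :=
      fun y => ‖y‖ ^ 2 • fderiv ℝ w y (w y) + ‖w y‖ ^ 2 • y with hUdef
    set V : EuclideanSpace ℝ (Fin 3) → EuclideanSpace ℝ (Fin 3) := fun z => (k : ℝ → ℝ) (‖z‖ ^ 2) • U z with hVdef
    have hkd : ContDiff ℝ 1 (k : ℝ → ℝ) := k.contDiff
    have hU1 : ContDiff ℝ 1 U := contDiff_bochnerField hw
    have hψ : ContDiff ℝ 1 fun z : EuclideanSpace ℝ (Fin 3) => (k : ℝ → ℝ) (‖z‖ ^ 2) :=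
      hkd.comp (contDiff_norm_sq ℝ)
    have hV1 : ContDiff ℝ 1 V := hψ.smul hU1
    -- compact support: `V = 0` outside the closed ball of radius `√(2ρ)`
    have hVc : HasCompactSupport V := by
      refine HasCompactSupport.intro (isCompact_closedBall (0 : EuclideanSpace ℝ (Fin 3)) (Real.sqrt (2 * ρ)))
        fun z hz => ?_
      rw [mem_closedBall, dist_zero_right, not_le] at hz
      have h2ρ : 2 * ρ < ‖z‖ ^ 2 := by
        have h1 : Real.sqrt (2 * ρ) ^ 2 = 2 * ρ := Real.sq_sqrt (by positivity)
        nlinarith [Real.sqrt_nonneg (2 * ρ), norm_nonneg z]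
      have hk0 : (k : ℝ → ℝ) (‖z‖ ^ 2) = 0 := by
        refine k.zero_of_le_dist ?_
        show ρ / 2 ≤ dist (‖z‖ ^ 2) ρ
        rw [Real.dist_eq, abs_of_pos (by linarith)]
        linarith
      simp only [hVdef, hk0, zero_smul]
    -- the divergence of `V`, pointwise
    have hdivV : ∀ z, VectorCalculus.divergence V z =
        (k : ℝ → ℝ) (‖z‖ ^ 2) * (‖z‖ ^ 2 * LinearMap.trace ℝ _ ((fderiv ℝ w z : EuclideanSpace ℝ (Fin 3) →ₗ[ℝ]
            EuclideanSpace ℝ (Fin 3)) ∘ₗ (fderiv ℝ w z : EuclideanSpace ℝ (Fin 3) →ₗ[ℝ] EuclideanSpace ℝ (Fin 3))) +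
          2 * ⟪w z, fderiv ℝ w z z⟫ + ‖w z‖ ^ 2) := by
      intro z
      rw [hVdef, divergence_radial_smul (hkd.differentiable one_ne_zero) (hU1.differentiable one_ne_zero)
        (inner_bochnerField_self hwd htan) z, hUdef, divergence_bochnerField hw htan hdiv z]
    -- nonnegativity (the algebraic heart) and the lower bound at `y₀`
    have hnonneg : ∀ z, 0 ≤ VectorCalculus.divergence V z := by
      intro z
      rw [hdivV z]
      refine mul_nonneg k.nonneg ?_
      have := key_ineq w z (w z) (inner_fderiv_apply_eq hwd htan z) (htan z) (hcurl z)
      positivity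
    have hint : ∫ z, VectorCalculus.divergence V z = 0 := integral_divergence_eq_zero hV1 hVc
    -- a continuous nonnegative compactly supported function with zero integral vanishes
    by_contra hne
    have hpos : 0 < VectorCalculus.divergence V y₀ := by
      rw [hdivV y₀]
      have hk1 : (k : ℝ → ℝ) (‖y₀‖ ^ 2) = 1 := k.one_of_mem_closedBall (by simp [hρ, k.rIn_pos.le])
      rw [hk1, one_mul]
      have := key_ineq w y₀ (w y₀) (inner_fderiv_apply_eq hwd htan y₀) (htan y₀) (hcurl y₀)
      have hwpos : 0 < ‖w y₀‖ ^ 2 := by positivity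
      linarith
    have := (continuous_divergence_of_contDiff_one hV1).integral_pos_of_hasCompactSupport_nonneg_nonzero
      (μ := (volume : Measure (EuclideanSpace ℝ (Fin 3))))
      (hasCompactSupport_divergence hVc) (fun z => hnonneg z) hpos.ne'
    linarith
  -- ### at the origin, by continuity (`{0}ᶜ` is dense)
  funext y
  by_cases hy : y ≠ 0
  · exact hoff y hy
  rw [not_ne_iff] at hy
  subst hy
  have hclosed : IsClosed {y : EuclideanSpace ℝ (Fin 3) | w y = 0} := isClosed_eq hw.continuous continuous_const
  have hdense : Dense ({0}ᶜ : Set (EuclideanSpace ℝ (Fin 3))) := dense_compl_singleton 0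
  have hsub : ({0}ᶜ : Set (EuclideanSpace ℝ (Fin 3))) ⊆ {y | w y = 0} := fun y hy => hoff y hy
  have : (0 : EuclideanSpace ℝ (Fin 3)) ∈ {y : EuclideanSpace ℝ (Fin 3) | w y = 0} := by
    rw [← hclosed.closure_eq]
    exact closure_mono hsub (hdense.closure_eq ▸ mem_univ _)
  exact this

end Summit.NavierStokesRegularity.NavierStokesRegularity.Theorems.ImplosionDoorTangentialCurlFreeTrivialityKinematics

end
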